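import Summits.ValiantsHypothesis.ValiantsHypothesis.Theorems.BarrierLeverPartitionMinorsPairSplit

/-!
# Route BarrierLever — Chow witnesses for partition minors (items 20172 / 20195): the TWIN SPLIT
# (a third block reduction: the `a`-twin rows against the columns containing `c`)

Helper file (`--supports stmt-ValiantsHypothesis-20195`; cell valiant-natproofs, rung V4, 𝒟-side of
door (c); seat val-np-p2 gen 7).  Closes NO item; definition-free.  Conventions of items 19717 /
20172 / 20195: a layout `(u, w)` of height `h` is HIT when some product of `h + h` affine forms has
nonsingular partition minor `det[coeff_{E (u i) (w j)} ∏ ℓ]`, `x_a = X (castAdd h a)`,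
`y_c = X (natAdd h c)`.

**The twin split (`chow_twinSplit`).**  Let `(u, w)` be a layout of height `h + 1` and `a`, `c`
coordinates, in block form: the last `m` columns CONTAIN `c`, the first `n` columns AVOID `c`; the
last `m` rows are `a`-TWINS — row `natAdd n i` avoids `a` and the row `castAdd m (t i)` among the
first `n` rows is exactly `insert a (u (natAdd n i))` — and the first `n` rows are arbitrary (they
contain the twin partners).  So the number of columns containing `c` equals the number of twin pairs
exhibited; NO condition relates the `a`-classes of the rows to the `c`-classes of the columns (the
literal splits `chow_pairSplit` / `chow_pairSplit_mixed` need such an equality, the peel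
`chow_peel` needs no twins at all).  If the two PROJECTED layouts of height `h` —
«first `n` rows with `a` deleted × first `n` columns» and «the `m` twin rows × last `m` columns with
`c` deleted» (pulled back along `a.succAbove` / `c.succAbove`) — are both hit, then `(u, w)` is hit.

Proof: one product `∏ ℓ'` of `h + h` forms hits both projected layouts
(`exists_common_chow_witness₂`); lift it (`…CoordinateLift`) and multiply by the gadget
`1 + x_a + y_c` (coefficients `1, 1, 1, 0` at `(∅,∅), ({a},∅), (∅,{c}), ({a},{c})`,
`coeff_twinGadget`).  By `coeff_partitionExpo_mul_pairFactor` the partition matrix in block form is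
`[[A, B], [C, D]]` with `A = F[u_i \ a, w_j]`, `B = [a ∉ u_i] F[u_i, w_j \ c]`, `C = F[u_{i'}, w_j]`,
`D = F[u_{i'}, w_j \ c]` (`F` the lifted witness's projected coefficients).  Subtracting from each
twin row its partner row (left multiplication by the unipotent `[[1, 0], [-N, 1]]`, `N` the twin
incidence matrix) kills `C` (the partner's `A`-row is `F[u_{i'}, ·]`) and leaves `D` (the partner's
`B`-row vanishes as it contains `a`), so `det = det A · det D` (`Matrix.det_fromBlocks_zero₂₁`).

Seat census (exact, memo HOME/val-np-p2/g7/MEMO-dense-engine-g7.md): together with the peel, the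
two literal splits and the `x ↔ y` swap the twin split leaves the thin-row residual at `h = 4`
unchanged (23 layouts), but it is a genuinely new reduction for LOCKED layouts of item 20172's core
engine (`chow_hit_of_core`): it needs `#{j : c ∈ w j} = #{a-twin pairs}` only.
WHAT THIS IS NOT: a reduction step (hits nothing by itself); nothing on items 20195 / 20172 / 19717
themselves, on crux stmt-ValiantsHypothesis-14610, or on `VP` versus `VNP`.
-/

set_option linter.dupNamespace false

namespace Summit.ValiantsHypothesis.ValiantsHypothesis.Theorems.BarrierLever.ChowFactor

open Finset MvPolynomial
open Summit.ValiantsHypothesis.ValiantsHypothesis.Theorems.BarrierLever.ProductStateSums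
  (castAdd_ne_natAdd partitionExpo_apply_castAdd partitionExpo_apply_natAdd)
open Summit.ValiantsHypothesis.ValiantsHypothesis.Theorems.BarrierLever.CorankRepair (partitionExpo_eq_iff)

noncomputable section

variable {h : ℕ}

/-! ## 1. The gadget `1 + x_a + y_c` -/

/-- The gadget involves only `x_a` and `y_c`. -/
theorem support_twinGadget (a c : Fin (h + 1)) :
    ∀ m ∈ ((C 1 + C 1 * X (Fin.castAdd (h + 1) a) + C 1 * X (Fin.natAdd (h + 1) c)) :
        MvPolynomial (Fin ((h + 1) + (h + 1))) ℂ).support,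
      ∀ v, ¬ (v = Fin.castAdd (h + 1) a ∨ v = Fin.natAdd (h + 1) c) → m v = 0 := by
  classical
  intro m hm v hv
  by_contra hne
  have hvars : v ∈ ((C 1 + C 1 * X (Fin.castAdd (h + 1) a) + C 1 * X (Fin.natAdd (h + 1) c)) :
      MvPolynomial (Fin ((h + 1) + (h + 1))) ℂ).vars :=
    (mem_vars_iff_mem_support v).mpr ⟨m, hm, Finsupp.mem_support_iff.mpr hne⟩
  have hsub : (C 1 + C (1 : ℂ) * X (Fin.castAdd (h + 1) a) + C (1 : ℂ) * X (Fin.natAdd (h + 1) c) :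
      MvPolynomial (Fin ((h + 1) + (h + 1))) ℂ).vars ⊆ {Fin.castAdd (h + 1) a, Fin.natAdd (h + 1) c} := by
    refine (vars_add_subset _ _).trans (Finset.union_subset ((vars_add_subset _ _).trans
      (Finset.union_subset ?_ ?_)) ?_)
    · rw [vars_C]
      exact Finset.empty_subset _
    · refine (vars_mul _ _).trans (Finset.union_subset ?_ ?_)
      · rw [vars_C]
        exact Finset.empty_subset _
      · rw [vars_X]
        exact Finset.singleton_subset_iff.mpr (by simp)
    · refine (vars_mul _ _).trans (Finset.union_subset ?_ ?_)
      · rw [vars_C]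
        exact Finset.empty_subset _
      · rw [vars_X]
        exact Finset.singleton_subset_iff.mpr (by simp)
  have hv' := hsub hvars
  simp only [Finset.mem_insert, Finset.mem_singleton] at hv'
  exact hv hv'

/-- **The four multilinear coefficients of the gadget**: `1` at `(∅, ∅)`, `({a}, ∅)`, `(∅, {c})`
and `0` at `({a}, {c})`. -/
theorem coeff_twinGadget (a c : Fin (h + 1)) (U W : Finset (Fin (h + 1)))
    (hU : U = ∅ ∨ U = {a}) (hW : W = ∅ ∨ W = {c}) :
    coeff (∑ a' ∈ U, Finsupp.single (Fin.castAdd (h + 1) a') 1 +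
        ∑ c' ∈ W, Finsupp.single (Fin.natAdd (h + 1) c') 1)
      ((C 1 + C 1 * X (Fin.castAdd (h + 1) a) + C 1 * X (Fin.natAdd (h + 1) c)) :
        MvPolynomial (Fin ((h + 1) + (h + 1))) ℂ) =
      if U = {a} ∧ W = {c} then 0 else 1 := by
  classical
  rw [← affine_pair_eq a c 1, coeff_partitionExpo_affine]
  have hane : ({a} : Finset (Fin (h + 1))) ≠ ∅ := Finset.singleton_ne_empty a
  have hcne : ({c} : Finset (Fin (h + 1))) ≠ ∅ := Finset.singleton_ne_empty c
  rcases hU with rfl | rfl <;> rcases hW with rfl | rfl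
  all_goals simp [hane, hcne, hane.symm, hcne.symm]

/-! ## 2. The twin split -/

/-- **TWIN SPLIT for Chow witnesses (block form).**  Columns `castAdd m j` avoid `c`, columns
`natAdd n j` contain `c`; the last `m` rows `natAdd n i` are `a`-twins: they avoid `a` and
`u (castAdd m (t i)) = insert a (u (natAdd n i))`.  If the projected layouts «first `n` rows (minus
`a`) × first `n` columns» and «twin rows × last `m` columns (minus `c`)» of height `h` are hit, so is
`(u, w)` at height `h + 1`. -/
theorem chow_twinSplit (a c : Fin (h + 1)) {n m : ℕ} (u w : Fin (n + m) → Finset (Fin (h + 1)))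
    (t : Fin m → Fin n)
    (hw0 : ∀ j : Fin n, c ∉ w (Fin.castAdd m j)) (hw1 : ∀ j : Fin m, c ∈ w (Fin.natAdd n j))
    (hu0 : ∀ i : Fin m, a ∉ u (Fin.natAdd n i))
    (hut : ∀ i : Fin m, u (Fin.castAdd m (t i)) = insert a (u (Fin.natAdd n i)))
    (h0 : ∃ ℓ : Fin (h + h) → MvPolynomial (Fin (h + h)) ℂ, (∀ q, (ℓ q).totalDegree ≤ 1) ∧
      (Matrix.of fun i j : Fin n => coeff
        (∑ b ∈ (u (Fin.castAdd m i)).preimage a.succAbove Fin.succAbove_right_injective.injOn,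
            Finsupp.single (Fin.castAdd h b) 1 +
          ∑ d ∈ (w (Fin.castAdd m j)).preimage c.succAbove Fin.succAbove_right_injective.injOn,
            Finsupp.single (Fin.natAdd h d) 1)
        (∏ q, ℓ q)).det ≠ 0)
    (h1 : ∃ ℓ : Fin (h + h) → MvPolynomial (Fin (h + h)) ℂ, (∀ q, (ℓ q).totalDegree ≤ 1) ∧
      (Matrix.of fun i j : Fin m => coeff
        (∑ b ∈ (u (Fin.natAdd n i)).preimage a.succAbove Fin.succAbove_right_injective.injOn,
            Finsupp.single (Fin.castAdd h b) 1 +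
          ∑ d ∈ (w (Fin.natAdd n j)).preimage c.succAbove Fin.succAbove_right_injective.injOn,
            Finsupp.single (Fin.natAdd h d) 1)
        (∏ q, ℓ q)).det ≠ 0) :
    ∃ ℓ : Fin ((h + 1) + (h + 1)) → MvPolynomial (Fin ((h + 1) + (h + 1))) ℂ,
      (∀ q, (ℓ q).totalDegree ≤ 1) ∧
      (Matrix.of fun i j : Fin (n + m) => coeff
        (∑ a' ∈ u i, Finsupp.single (Fin.castAdd (h + 1) a') 1 +
          ∑ c' ∈ w j, Finsupp.single (Fin.natAdd (h + 1) c') 1)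
        (∏ q, ℓ q)).det ≠ 0 := by
  classical
  obtain ⟨ℓ, hdeg, hA, hD⟩ := exists_common_chow_witness₂ _ _ _ _ h0 h1
  -- the lift and the gadget (padded with the constant form `1`)
  set L : Fin (h + h) → Fin ((h + 1) + (h + 1)) := Fin.append
    (fun b : Fin h => Fin.castAdd (h + 1) (a.succAbove b))
    (fun d : Fin h => Fin.natAdd (h + 1) (c.succAbove d)) with hL
  set f₁ : MvPolynomial (Fin ((h + 1) + (h + 1))) ℂ :=
    C 1 + C 1 * X (Fin.castAdd (h + 1) a) + C 1 * X (Fin.natAdd (h + 1) c) with hf₁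
  have hcard : (h + h) + 2 = (h + 1) + (h + 1) := by omega
  set e : Fin ((h + h) + 2) ≃ Fin ((h + 1) + (h + 1)) := finCongr hcard with he
  set ℓ' : Fin ((h + h) + 2) → MvPolynomial (Fin ((h + 1) + (h + 1))) ℂ :=
    Fin.append (fun q => rename L (ℓ q)) ![f₁, 1] with hℓ'
  refine ⟨fun q => ℓ' (e.symm q), fun q => ?_, ?_⟩
  · show (ℓ' (e.symm q)).totalDegree ≤ 1
    generalize e.symm q = q₀
    rw [hℓ']
    induction q₀ using Fin.addCases with
    | left q' =>
      rw [Fin.append_left]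
      exact totalDegree_rename_le_one L (ℓ q') (hdeg q')
    | right q' =>
      rw [Fin.append_right]
      fin_cases q'
      · exact totalDegree_affine_pair_le a c 1
      · show (1 : MvPolynomial (Fin ((h + 1) + (h + 1))) ℂ).totalDegree ≤ 1
        rw [totalDegree_one]
        exact Nat.zero_le _
  · -- the product
    have hprod : (∏ q, ℓ' (e.symm q)) = f₁ * rename L (∏ q, ℓ q) := by
      rw [Fintype.prod_equiv e.symm (fun q => ℓ' (e.symm q)) ℓ' (fun _ => rfl), hℓ',
        Fin.prod_univ_add]
      simp only [Fin.append_left, Fin.append_right, Fin.prod_univ_two, Matrix.cons_val_zero,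
        Matrix.cons_val_one]
      rw [map_prod, mul_one, mul_comm]
    rw [hprod]
    -- the projected coefficient `F U W` of the witness at `(U \ a, W \ c)` (pulled back)
    set F : Finset (Fin (h + 1)) → Finset (Fin (h + 1)) → ℂ := fun U W => coeff
        (∑ b ∈ U.preimage a.succAbove Fin.succAbove_right_injective.injOn,
            Finsupp.single (Fin.castAdd h b) 1 +
          ∑ d ∈ W.preimage c.succAbove Fin.succAbove_right_injective.injOn,
            Finsupp.single (Fin.natAdd h d) 1) (∏ q, ℓ q) with hFdef
    -- entries of the partition matrix
    have hentry : ∀ i j : Fin (n + m), coeff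
        (∑ a' ∈ u i, Finsupp.single (Fin.castAdd (h + 1) a') 1 +
          ∑ c' ∈ w j, Finsupp.single (Fin.natAdd (h + 1) c') 1) (f₁ * rename L (∏ q, ℓ q)) =
        (if u i ∩ {a} = {a} ∧ w j ∩ {c} = {c} then (0 : ℂ) else 1) * F (u i) (w j) := by
      intro i j
      rw [coeff_partitionExpo_mul_pairFactor _ _ a c (support_twinGadget a c)
        (support_rename_lift a c _) (u i) (w j)]
      have hfa : (u i).filter (fun a' => a' = a) = u i ∩ {a} := by
        ext x; simp [Finset.mem_filter, Finset.mem_inter]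
      have hfc : (w j).filter (fun c' => c' = c) = w j ∩ {c} := by
        ext x; simp [Finset.mem_filter, Finset.mem_inter]
      rw [hfa, hfc, coeff_twinGadget a c _ _ ?_ ?_, erase_eq_map_preimage_succAbove,
        erase_eq_map_preimage_succAbove, coeff_lift_rename]
      · by_cases ha : a ∈ u i
        · right; rw [Finset.inter_singleton_of_mem ha]
        · left; rw [Finset.inter_singleton_of_notMem ha]
      · by_cases hc : c ∈ w j
        · right; rw [Finset.inter_singleton_of_mem hc]
        · left; rw [Finset.inter_singleton_of_notMem hc]
    -- the projected coefficient only sees `U \ a`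
    have hFerase : ∀ U W : Finset (Fin (h + 1)), F (U.erase a) W = F U W := by
      intro U W
      rw [hFdef]
      dsimp only
      congr 3
      ext b
      simp only [Finset.mem_preimage, Finset.mem_erase, Fin.succAbove_ne, ne_eq, not_false_eq_true,
        true_and]
    -- block form
    have hane : ({a} : Finset (Fin (h + 1))) ≠ ∅ := Finset.singleton_ne_empty a
    have hcne : ({c} : Finset (Fin (h + 1))) ≠ ∅ := Finset.singleton_ne_empty c
    set A : Matrix (Fin n) (Fin n) ℂ := Matrix.of fun i j : Fin n =>
      F (u (Fin.castAdd m i)) (w (Fin.castAdd m j)) with hAdef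
    set B : Matrix (Fin n) (Fin m) ℂ := Matrix.of fun (i : Fin n) (j : Fin m) =>
      (if a ∈ u (Fin.castAdd m i) then (0 : ℂ) else 1) * F (u (Fin.castAdd m i)) (w (Fin.natAdd n j))
      with hBdef
    set Cm : Matrix (Fin m) (Fin n) ℂ := Matrix.of fun (i : Fin m) (j : Fin n) =>
      F (u (Fin.natAdd n i)) (w (Fin.castAdd m j)) with hCdef
    set D : Matrix (Fin m) (Fin m) ℂ := Matrix.of fun i j : Fin m =>
      F (u (Fin.natAdd n i)) (w (Fin.natAdd n j)) with hDdef
    have hN : (Matrix.of fun i j : Fin (n + m) => coeff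
        (∑ a' ∈ u i, Finsupp.single (Fin.castAdd (h + 1) a') 1 +
          ∑ c' ∈ w j, Finsupp.single (Fin.natAdd (h + 1) c') 1) (f₁ * rename L (∏ q, ℓ q))) =
        Matrix.reindex finSumFinEquiv finSumFinEquiv (Matrix.fromBlocks A B Cm D) := by
      ext i j
      rw [Matrix.of_apply, hentry, Matrix.reindex_apply, Matrix.submatrix_apply]
      induction i using Fin.addCases with
      | left i₀ =>
        induction j using Fin.addCases with
        | left j₀ =>
          rw [finSumFinEquiv_symm_apply_castAdd, finSumFinEquiv_symm_apply_castAdd,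
            Matrix.fromBlocks_apply₁₁, hAdef, Matrix.of_apply,
            Finset.inter_singleton_of_notMem (hw0 j₀)]
          simp [hcne.symm]
        | right j₁ =>
          rw [finSumFinEquiv_symm_apply_castAdd, finSumFinEquiv_symm_apply_natAdd,
            Matrix.fromBlocks_apply₁₂, hBdef, Matrix.of_apply,
            Finset.inter_singleton_of_mem (hw1 j₁)]
          by_cases ha : a ∈ u (Fin.castAdd m i₀)
          · rw [Finset.inter_singleton_of_mem ha]; simp [ha]
          · rw [Finset.inter_singleton_of_notMem ha]; simp [ha, hane.symm]
      | right i₁ =>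
        induction j using Fin.addCases with
        | left j₀ =>
          rw [finSumFinEquiv_symm_apply_natAdd, finSumFinEquiv_symm_apply_castAdd,
            Matrix.fromBlocks_apply₂₁, hCdef, Matrix.of_apply,
            Finset.inter_singleton_of_notMem (hu0 i₁), Finset.inter_singleton_of_notMem (hw0 j₀)]
          simp [hane.symm]
        | right j₁ =>
          rw [finSumFinEquiv_symm_apply_natAdd, finSumFinEquiv_symm_apply_natAdd,
            Matrix.fromBlocks_apply₂₂, hDdef, Matrix.of_apply,
            Finset.inter_singleton_of_notMem (hu0 i₁), Finset.inter_singleton_of_mem (hw1 j₁)]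
          simp [hane.symm]
    -- the twin incidence matrix and the unipotent row operation
    set N : Matrix (Fin m) (Fin n) ℂ := Matrix.of fun i' i => if i = t i' then (1 : ℂ) else 0
      with hNdef
    have hNA : N * A = Cm := by
      ext i' j
      rw [Matrix.mul_apply, Finset.sum_eq_single (t i')]
      · rw [hNdef, hAdef, hCdef, Matrix.of_apply, Matrix.of_apply, Matrix.of_apply, if_pos rfl,
          one_mul, hut i', ← hFerase (insert a _), Finset.erase_insert (hu0 i')]
      · intro i _ hi
        rw [hNdef, Matrix.of_apply, if_neg hi, zero_mul]
      · intro ht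
        exact absurd (Finset.mem_univ _) ht
    have hNB : N * B = 0 := by
      ext i' j
      rw [Matrix.mul_apply, Matrix.zero_apply, Finset.sum_eq_single (t i')]
      · rw [hNdef, hBdef, Matrix.of_apply, Matrix.of_apply, if_pos rfl, one_mul, hut i',
          if_pos (Finset.mem_insert_self a _), zero_mul]
      · intro i _ hi
        rw [hNdef, Matrix.of_apply, if_neg hi, zero_mul]
      · intro ht
        exact absurd (Finset.mem_univ _) ht
    have hE : Matrix.fromBlocks (1 : Matrix (Fin n) (Fin n) ℂ) 0 (-N) (1 : Matrix (Fin m) (Fin m) ℂ) *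
        Matrix.fromBlocks A B Cm D = Matrix.fromBlocks A B 0 D := by
      rw [Matrix.fromBlocks_multiply, Matrix.neg_mul, Matrix.neg_mul, hNA, hNB]
      simp only [Matrix.one_mul, Matrix.zero_mul, add_zero, neg_zero, zero_add, neg_add_cancel]
    have hdetE : (Matrix.fromBlocks (1 : Matrix (Fin n) (Fin n) ℂ) 0 (-N)
        (1 : Matrix (Fin m) (Fin m) ℂ)).det = 1 := by
      rw [Matrix.det_fromBlocks_zero₁₂, Matrix.det_one, Matrix.det_one, mul_one]
    have hdet : (Matrix.fromBlocks A B Cm D).det = A.det * D.det := by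
      have := congrArg Matrix.det hE
      rw [Matrix.det_mul, hdetE, one_mul, Matrix.det_fromBlocks_zero₂₁] at this
      exact this
    rw [hN, Matrix.det_reindex_self, hdet]
    exact mul_ne_zero hA hD

end

end Summit.ValiantsHypothesis.ValiantsHypothesis.Theorems.BarrierLever.ChowFactor
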